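import Literature.MathematicalPhysics.QuantumFieldTheory.Balaban1983to89.B11Prop3Model
import Literature.MathematicalPhysics.QuantumFieldTheory.Balaban1983to89.DagBinding

/-!
# `Balaban1983to89.B11Carve12SectsBCHyp` — [B11] pp. 281–289 (Sect. B «An Expansion of the Action», displays (24)–(43);
# Sect. C «A Construction of the Linearizing Transformation», displays (44)–(69); Proposition 3, p. 289) CARVED: the block's
# printed statements conjoined BY NAME into one hypothesis bundle `Hyp` over the Sect. A–E carrier `B11.LGData`, keyed to
# `stmt-QuantumFields-19200` (also feeds `stmt-QuantumFields-20541`), the one printed sentence of the range with no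
# declaration in the tree typed hypothesis-form (`Defined287Printed`, p. 287 ll. 4–5), the bundle INHABITED by name for the
# Sect. C model family of `B11Prop3Model` (non-vacuity, kernel-checked), and the in-tree citation index of the block's twenty
# SKELETON rows

statement-level skeleton of published theorems with citation tags; proofs where landed; nothing here is a claim about the
Yang–Mills mass gap

CITATION HEADER (lean-in-tree rule).  B11 = T. Bałaban, *The variational problem and background fields in renormalization
group method for lattice gauge theories*, Commun. Math. Phys. **102** (1985) 277–309 [Balaban1985Variational]
(doi:10.1007/bf01229381; held `paper:balaban1985-cmp102-variational-background`, journal page = PDF page + 276; text layer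
`pNNNN.txt` of `lit read`; the page renders `pub/pub-balaban/b2b-balaban-ref1/pages/1985-cmp102-variational-background/…-p005-x2.png
… -p013-x2.png` of pp. 281–289 were READ AS IMAGES by this seat, 2026-08-28).  References of the paper as used on these
pages: [3] = B6 = T. Bałaban, *Propagators and renormalization transformations for lattice gauge theories. II*, Commun.
Math. Phys. **96** (1984) 223–250 [Balaban1984PropagatorsII]; [4] = B7 = T. Bałaban, *Averaging operations for lattice gauge
theories*, Commun. Math. Phys. **98** (1985) 17–51 [Balaban1985Averaging]; [5] = B9 = T. Bałaban, *Propagators for lattice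
gauge theories in a background field*, Commun. Math. Phys. **99** (1985) 389–434 [Balaban1985BackgroundPropagators]; [6] =
B8 = T. Bałaban, *Spaces of regular gauge field configurations on a lattice and gauge fixing conditions*, Commun. Math.
Phys. **99** (1985) 75–102 [Balaban1985RegularSpaces].  Cell `lit-balaban`, P6 CARVING FAN (D-0154 (3b)), BLOCK 12 of
`carve/BLOCKS-11-20.md` (lead g30, 2026-08-28T05:30Z; `carve/CARVE-LIST.md` § Block 12): source section = [B11] Sect. B and
Sect. C, journal pp. 281–289 [PDF 5–13]; KEY item `stmt-QuantumFields-19200` (R3 `MinimiserStabilityRegPr`); also feeds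
`stmt-QuantumFields-20541` (K0⁷ `Record13SepCoPHInhabited`).  Seat `lit-balaban-carve-12`
(literature-prover-lit-balaban-carve-12-g0-0).  Rules `carve/CARVE-RULES.md`: in tree = cite, never restate; hypothesis
form; no `instance`, no `notation`; 0 sorry; desk stems (`Node00/*`, `T3*`, `T4*`, `B11Thm1*`, `B11Leaf*`, and the
decade-1 list `B8Thm2Torus*`, `B8Prop5*`, `B9B8*`, `B9Eq3104*`, `B9Thm310*`, `B9CubeSequence408*`, `B9Thm37GpTorusRegular*`)
untouched — cited by name only.  NEIGHBOURS: block 11 (Intro + Sect. A, pp. 277–281, through Proposition 2 and (22)–(23),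
stem `B11Carve11IntroSectAHyp`) and block 13 (Sect. D from (70), pp. 289–294, stem `B11Carve13SectDHyp`; the rows
(70)–(73) of p. 289 are block 13's and are listed below for continuity only, because Proposition 3 quotes (73)).

WHAT THIS FILE IS.  The block is IN TREE at statement level (20 SKELETON rows of v3.368: proved 9, typed-existing 6,
proved-existing 5; `carve/BLOCKS-11-20.md` counts 0 residual display labels among the 43 labels of (24)–(69) its text
layer sees).  Accordingly
this file (i) RESTATES NOTHING that has a declaration: every row is cited by name in the INDEX below; the ONE row realised by
a HYPOTHESIS-FORM declaration over the block's own carrier — Proposition 3, `B11.Prop3Printed` over `fam : I → B11.LGData` —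
is USED, by name, in the bundle `Hyp`; the rows realised by PROVED theorems or by definitions with bodies (all of Sect. B,
and (47)–(69) of Sect. C) are cited only — a proved statement is not a hypothesis; the two rows realised by typed statements
OF THE CITED PAPERS over those papers' own carriers ((44) = [4] Prop. 4 `B7.Prop4Printed`, (45)–(46) = [5] Thm 3.12
`B9.Thm312_313Printed`) are cited, not conjoined: at the level of `B11.LGData` they are the content of the hypothesis (14)
at the background U₀, the field `Sat14` (reading (M2) of `B11Prop3Model`: `Sat14 _ _ _ U₀ := B11Prop3Model.Inputs (Ct U₀)
(hop U₀) C₂ C₃ B₀ c₄`); (ii) types, hypothesis-form over `fam : I → B11.LGData`, the one printed sentence of pp. 281–289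
found on a page-by-page read that no declaration of the tree states as printed and that no SKELETON row covers —
`Defined287Printed` (p. 287 [PDF 11] ll. 4–5 = `p0011.txt:L4–L5`: «The transformation is defined for ε₃ satisfying 2ε₃ ≤ c₄
(see Proposition 4 in [4]) and ε₃ ≤ (18C₂B₀)⁻¹.» — the definedness of the linearizing transformation (47) under the
NORM-LEVEL threshold of pp. 285–287, as opposed to the «e.g. 18C₂B₀dc₁(½)ε₃ ≤ 1, 2ε₃ ≤ c₄» under which Proposition 3
(p. 289) gathers it together with (73), whose Neumann series (71) is where the factor d·c₁(½) enters); (iii) defines ONE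
bundle `Hyp` = the conjunction, by name, of (ii) and Proposition 3, plus its spelling `HypAt Z` at the consumer's carrier
record `DagBinding.PrintedCarriers11` (the record over which N07's leaf `DagBinding.B11Leaf` is stated); (iv) records
(§3, pointers) and kernel-checks (§4: `hyp_iff`, the projections, `Hyp.def47` ∕ `Hyp.def47_eg` with the printed threshold
arithmetic `threshold287_of_289`, the slot theorems `HypAt.leafP3` ∕ `hypAt_of_leaf`, and the INHABITANT `hyp_model` — the
bundle holds, by name, for every model family of `B11Prop3Model.LinDatum`, from `B11Prop3Model.prop3Printed_model` and the
new `defined287_model`) how the bundle sits in the tree.  It moves no node count and proves no summit statement.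

INDEX — the twenty SKELETON rows of block 12 and the unnumbered sentences between them — row id · printed item · page:
journal [PDF] (text-layer lines) · IN-TREE declarations cited BY NAME (all under
`Literature.MathematicalPhysics.QuantumFieldTheory.Balaban1983to89.`; «used» = conjoined in `Hyp` below; «proved» ∕ «def» = a
theorem ∕ a definition with body in the tree, hence not a hypothesis here; «typed» = a hypothesis-form `Prop` of another
carrier, cited):
* Sect. B opening · «The configuration U₀ and the scale η are fixed … we will write R, D instead of R(U₀), D^η_{U₀}» ·
  p. 281 [5] (`p0005.txt:L30–L33`) · convention; (22)–(23) are block 11's row B11.Eq22 (`B11Eq22Remainder.expRemainder`,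
  `B11Eq22Remainder.exp_eq_taylor_four`, `B11Eq22Remainder.norm_expRemainder_I_smul_le_one` — proved).
* B11.Eq24 · (24) «tr(U₁U₀)(∂p) = tr ∂₀U₁((p)_z)U₀(∂p)» and (25), with «The expression in parenthesis (…) on the right-hand
  side is equal to η(DA)(p)» · p. 282 [6] (`p0006.txt:L2–L12`) · `B8Eq143PlaqExpansion.eq121` (proved, the cited (1.21) of
  [6]), `B11Eq24TraceExpansion.covPlaqZ` (def), `B11Eq24TraceExpansion.eq24`, `B11Eq24TraceExpansion.eq25_printed`,
  `B11Eq24TraceExpansion.linZ_eq_smul_plaqCovDeriv` (the parenthesis = η(DA)(p)), `B11Eq34BCH.bracket25_eq` (proved).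
* B11.Eq24 (cont.) · (26) «A(U₁U₀) = A(U₀) + Σ η^{d−2} Im tr(DA)(p)U₀(∂p) + ½⟨A, ΔA⟩ + V₀(A), where the expansion of V₀(A)
  begins with a third order polynomial» · p. 282 [6] (`p0006.txt:L13–L15`) · `B11Eq26ActionExpansion.V0` (def),
  `B11Eq26ActionExpansion.eq26`, `B11Eq26ActionExpansion.eq26_printed`, `B11Eq26ActionExpansion.V0_eq_sum_rem3`,
  `B11Eq26ActionExpansion.norm_V0_le_cubic` (proved); `B11Eq26ExpansionZpow.V0Z` (def, the (5)-normalised form).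
* B11.Eq27 · (27) «From hermiticity of DA we have … = ⟨A, J⟩», (28) «J = D*η⁻² Im ∂U₀ = Im η⁻²D*∂U₀, |J| < C₁B₃ε₁(L^jη)⁻³ on
  Ω_j, the bound holds by the assumption (14)» · p. 282 [6] (`p0006.txt:L16–L21`) · `B11Eq27Current.eq27`,
  `B11Eq27Current.J_eq_imPart_div`, `B11Eq27Current.ineq28` (proved, from the (14)-shaped plaquette hypothesis);
  `B11Eq27Current.imPart`, `B11Eq98CurrentSlot.Jcur` (defs).
* unnumbered · «The action A(U₁U₀) is an analytic, and even an entire function of A for A ∈ 𝔤ᶜ, or for A in the space of all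
  complex N × N matrices, so V₀(A) is such a function also.» · p. 282 [6] (`p0006.txt:L21–L23`) ·
  `B11Eq90V0GroupComposed.differentiable_V0` (proved: V₀ is ℂ-differentiable everywhere), `B11Eq36Complex.V0p_eq29_complex`,
  `B11Eq90V0primeBond.contDiff_V0p` (proved) — PROVED, hence cited, not typed.
* B11.Eq29 · (29)–(30) «V₀ = V⁽³⁾ + V₄», (31) «|V₄(A, ∂p)| ≤ (1/4!)(|A|(∂p))⁴e^{η|A|(∂p)}» · p. 282 [6] (`p0006.txt:L24–L32`) ·
  `B11Eq26ActionExpansion.V3`, `B11Eq26ActionExpansion.V4`, `B11Eq26ActionExpansion.V3p`, `B11Eq26ActionExpansion.V4p`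
  (defs), `B11Eq26ActionExpansion.eq29`, `B11Eq26ActionExpansion.eq30a`, `B11Eq26ActionExpansion.eq30b`,
  `B11Eq31V4Bound.ineq31`, `B11Eq26ActionExpansion.ineq31_V4p` (proved).
* B11.Eq32 · (32) «L^jη|A|, (L^jη)²|∇A| < ε₂ on Ω_j, where B₁(ε₀ + C₁ε₁) ≤ ε₂», «let us assume for simplicity that 32ε₂ ≤ 1
  … This implies e^{η|A|(∂p)} < e^{4ε₂} < 2» · pp. 282–283 [6–7] (`p0006.txt:L33–L35`, `p0007.txt:L2`) · row cite `B11.LGData`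
  (field `In43`: the working bounds (32) = (43)); `B11Smallness.exp_eta_contour_lt_two`, `B11Eq36Complex.exp_le_two_of_32`
  (proved).
* B11.Eq29 (cont.) · (33) «|V₄(A, ∂p)| ≤ (2/4!)(|A|(∂p))⁴ ≤ 2⁵|A|⁴ < 2⁵ε₂⁴(L^jη)⁻⁴» · p. 283 [7] (`p0007.txt:L3`) ·
  `B11Smallness.ineq33`, `B11Eq31V4Bound.ineq31_mono` (proved).
* B11.Eq34 · «In [5] we have found the explicit expressions (3.7), (3.10) for the second order term», the variables A′(b),
  (34) (third-order Baker–Campbell–Hausdorff) · p. 283 [7] (`p0007.txt:L4–L17`) · `B11Eq34BCH.Aprime`, `B11Eq34BCH.Z1`,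
  `B11Eq34BCH.comm2`, `B11Eq34BCH.comm3pair`, `B11Eq34BCH.comm3triple` (defs), `B11Eq34BCH.bch4_degree2`,
  `B11Eq34BCH.bch4_degree3`, `B11Eq34Analytic.eq34`, `B11Eq34Analytic.eq34_printed`, `B11Eq34Analytic.eq34_Aprime_regime32`
  (proved: (34) with remainder control in the regime 32ε₂ ≤ 1).
* B11.Eq34 (cont.) · (35)–(36) (V⁽³⁾ explicit) · pp. 283–284 [7–8] (`p0007.txt:L18–L24`, `p0008.txt:L2–L3`) · `B11Eq34BCH.V3`,
  `B11Eq34BCH.V3_eq`, `B11Eq31V4Bound.eq36_of_eq35`, `B11Eq26ActionExpansion.V3p_eq_eq36`,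
  `B11Eq36Complex.V3p_eq_eq36_complex` (proved, also for complex A).
* B11.Eq37 · (37) «|V⁽³⁾(A, ∂p)| ≤ ½|(DA)(p)|(|A|(∂p))² + ½η(|A|(∂p))³C₁B₃ε₁(L^jη)⁻² ≤ … < 16ε₂³(1 + 2C₁B₃ε₁)(L^jη)⁻⁴» ·
  p. 284 [8] (`p0008.txt:L4–L7`) · `B11Eq37NormBound.norm_V3_le`, `B11Eq37NormBound.ineq37_printed`, `B11Smallness.ineq37`,
  `B11Eq36Complex.ineq37_first_complex` (proved).
* unnumbered · «The first trace on the right-hand side of (36) depends on the derivative (DA)(p), the remaining expressions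
  depend on the field variables A only» · p. 284 [8] (`p0008.txt:L8–L10`) · structural: the tree's `B11Eq90V0primeBond.term39`
  ∕ `B11Eq90V0primeBond.V0primeP` are functions of the bond variables of ∂p by definition (`B11Eq90V0primeBond.V0primeP_eq`,
  `B11Eq90V0primeBond.term39_add_smul_of_letters_zero`) — nothing to type.
* B11.Eq38 · (38) «|η⁻²(Re U₀(∂p) − 1)| < C₁B₃ε₁(L^jη)⁻²» · p. 284 [8] (`p0008.txt:L11–L12`) · `B11Eq22Remainder.ineq38` (proved).
* B11.Eq39 · (39) «V₀(A, ∂p) = ½tr(DA)(p)Σ_{b₁≺b₂} i[A′(b₁), A′(b₂)] + V′₀(A, ∂p)», (40) «|V′₀(A, ∂p)| ≤ … < 64ε₂³(C₁B₃ε₁ +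
  ε₂)(L^jη)⁻⁴», «Here we have used only the first bound (32) on the field A alone» · p. 284 [8] (`p0008.txt:L13–L20`) ·
  `B11Eq37NormBound.V3_split39`, `B11Eq37NormBound.ineq40_first`, `B11Eq37NormBound.ineq40_printed`, `B11Smallness.ineq40`
  (proved; the hypotheses are bounds on |A| only, as printed), `B11Eq36Complex.ineq40_printed_complex`,
  `B11Eq90V0primeBond.V0primeP`, `B11Eq90V0primeBond.term39`, `B11Eq63V0GroupCurrent.curV0` (defs ∕ proved).
* unnumbered · «The quadratic form ½⟨A, ΔA⟩ was thoroughly investigated in [5]. … the configurations A satisfy the Landau gauge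
  condition RD*A = 0, and we replace the form Δ by Δ_π defined in [5], the formulas (3.119), (3.120)» · p. 284 [8]
  (`p0008.txt:L21–L25`) · [5] (3.119) «⟨A, Δ_πA⟩ = ⟨A − DG′RD*A, Δ(A − DG′RD*A)⟩» (so Δ_π agrees with Δ on RD*A = 0):
  `B9Eq3119DeltaPiCarrier.deltaPi` (def := πᵗΔπ), `B9Eq3119DeltaPiCarrier.tpair_deltaPi`, `B9Eq3117Current.hessPi`,
  `B9Eq3117Current.eq3120` (proved ∕ defs of [5]'s statements); its use on p. 291 (87): `B11Eq88LaplaceH1CurrentSymmetry.tpair_laplaceAkPi_sub_QaQ_comm`.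
  A statement of [5] with a body in the tree — cited, not typed (and not expressible over `B11.LGData`, which has no
  quadratic-form letter).
* B11.Eq41 · (41)–(43) «We are looking for a minimum of the functional A(e^{iηA}U₀) = A(U₀) + ⟨A, J⟩ + ½⟨A, Δ_πA⟩ + V₀(A) on
  the space RD*A = 0, Q(ηA) = B on 𝔅_k, |B| < 2dLC₁ε₁, |A| < ε₂(L^jη)⁻¹, |∇A| < ε₂(L^jη)⁻² on Ω_j» · pp. 284–285 [8–9]
  (`p0008.txt:L26–L30`, `p0009.txt:L2`) · row cite `B11.LGData` (field `In43`); `B11Prop7Model.ChartDatum.Kset` ((75)–(76), the same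
  constraint set after (47)), `B11GlobalMin.ChartCovers` (defs); desk stems cited only: `T3SectALandauChart.Resid` ((43)).
  The sentences «We would like to prove that for ε₀, ε₁, ε₂ properly restricted there exists exactly one minimal
  configuration …» and «Our next step will be to make a change of variables such that the function Q will become a linear
  function» (p. 285, `p0009.txt:L3–L6`) announce Sects. C–E and carry no statement of their own.
* Sect. C opening · «This construction will be almost identical to the construction of the corresponding linearizing
  transformation in the Sect. E of [6]» · p. 285 [9] (`p0009.txt:L8–L9`) · cross-reference, no statement.
* B11.Eq44 · (44) «The Proposition 4 of [4] implies Q_j(ηA) = L^jηQ_jA + C_j(L^jηA), |C_j(L^jηA)| ≤ C₂(L^jη)²|A|²» · p. 285 [9]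
  (`p0009.txt:L9–L10`) · `B7.Prop4Printed` (typed, [4]'s carrier `B7.KExp`; complex form `B7.Prop7Printed`) — cited, not
  conjoined (other carrier; at `B11.LGData` level inside `Sat14`, see `B11Prop3Model.Inputs`); concrete:
  `B11Eq44COperatorTorus.Cblock`, `B11Eq44COperatorTorus.eq44`, `B11Eq44COperatorTorus.norm_Cblock_le`,
  `B11Eq44COperatorTorus.Cc`, `B11Eq44COperatorTorus.quadAnalytic_Cc`, `B11Eq44Concrete.Cmap`,
  `B11Eq44Concrete.quadAnalytic_Cmap`, `B11Eq44CLetterTower.Cck` (defs ∕ proved).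
* B11.Eq45 · «The operators Δ, Q and R define the operator H … an operator defined on configurations B and giving a minimum
  of the quadratic form ½⟨A, ΔA⟩ under the restrictions L^jηQ_jA = B on Λ_j, …, RD*A = 0», (45) «L^jηQ_jHB = B on Λ_j,
  RD*HB = 0», (46) «the Theorem 3.12 from [5] implies |HB| ≤ B₀(L^jη)⁻¹|B|, |∇HB| ≤ B₀(L^jη)⁻²|B| on Ω_j» · p. 285 [9]
  (`p0009.txt:L11–L17`) · `B9.Thm312_313Printed`, `B9.Thm312Printed` (typed, [5]'s carriers) — cited, not conjoined (other
  carrier; inside `Sat14` at `B11.LGData` level, `B11Prop3Model.Inputs` field `norm_H`); the minimiser characterization =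
  [5] (3.126): `B9Eq3112.minOp_piOp_eq_hOp` (proved); concrete H: `B11Eq45HOperator.Hop`, `B11Eq45HOperator.norm_Hop_le`,
  `B11Eq45HOperatorLattice.HopLattice`, `B11Eq45HOperatorLattice.Q_HopLattice` ((45)₁), `B11Eq45HOperatorLattice.RDstar_H1Lattice`
  ((45)₂), `B11Eq103H1Complex.H1LatticeCLM` (defs ∕ proved).
* B11.Eq47 · (47) «A = A′ − HD(A′)», (48), (49) «C_j(L^jηA′ − L^jηHD(A′)) = D(A′) on Λ_j», (50) «Thus the function D(A′) is a
  fixed point of the transformation X → C_j(L^jηA′ − L^jηHX)» · p. 285 [9] (`p0009.txt:L18–L27`) · row cite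
  `B11Eq90V0GroupComposed.T47` (def), `B11Eq90V0GroupComposed.T47_eq`; `B11.LGData` fields `T47`, `Def47`, `normD`;
  `B12Lineariz267.linearizes_iff` ((48) ⇔ (49), proved), `B12Lineariz267.linearizes`, `B12Lineariz267.fixedPt_of_linearizes`,
  `B11Prop3Model.Dfix` (D(A′) as a function), `B11Eq80Current.Emap` (defs ∕ proved).
* B11.Eq51 · (51) «|A′| < ε₃(L^jη)⁻¹ on Ω_j, X = 0 on Λ₀, |X| < ε₃/B₀ on 𝔅_k», (52) «|C_j(L^jηA′ − L^jηHX)| ≤ C₂(L^jη|A′| +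
  L^jη|HX|)² < 4C₂ε₃², and its value is in the set … if 4C₂ε₃² ≤ ε₃/B₀, i.e. ε₃ ≤ (4C₂B₀)⁻¹», (53)–(54) «Taking r =
  ε₃(B₀|X₁ − X₂|)⁻¹, we get … = 9C₂B₀ε₃|X₁ − X₂|» · pp. 285–286 [9–10] (`p0009.txt:L28–L35`, `p0010.txt:L2–L10`) · row cite
  `B13Contraction113.bound_113` (proved), with `B13Contraction113.QuadAnalytic` (the hypothesis structure of (44) for
  complex arguments), `B13Contraction113.mapsTo_T` (self-map), `B13Contraction113.norm_sub_le_of_sphere_bound` (the Cauchy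
  step of (53)), `B13Contraction113.lipschitz_T` ((54)), `B13Contraction113.contraction_constant` (proved).
* unnumbered · «Hence the transformation is contractive if 9C₂B₀ε₃ < 1; for example we take 9C₂B₀ε₃ ≤ 1/2, i.e. ε₃ ≤
  (18C₂B₀)⁻¹. The contraction mapping theorem implies that for arbitrary A′, satisfying L^jη|A′| < ε₃ on Ω_j, there exists
  exactly one fixed point of the transformation (50), thus exactly one solution of Eq. (49). This solution is a limit of
  uniformly convergent sequence of successive approximations and it is an analytic function of A′. It satisfies the bound
  |D(A′)| < ε₃/B₀, but ε₃ was arbitrary, so we can take it arbitrarily close to … |A′|₍₋₁₎, and we get the bound |D(A′)| ≤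
  B₀⁻¹|A′|₍₋₁₎.» · p. 286 [10] (`p0010.txt:L11–L18`) · `B12Lineariz267.smallness_of_le` (18C₂B₀ε₃ ≤ 1 ⇒ 9C₂B₀ε₃ < 1 ∧
  4C₂B₀ε₃ ≤ 1), `B11Smallness.ineq57`, `B13Contraction113.exists_unique_fixedPoint` (contraction mapping theorem on the
  complete ball), `B13Contraction113.differentiableOn_fixedPoint` ∕ `B13Contraction113.analytic_fixedPoint_113` («limit of
  uniformly convergent sequence of successive approximations … analytic»), `B12Lineariz267.exists_Dt`, `B12Lineariz267.Dt_unique`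
  (proved).  The intermediate linear bound |D(A′)| ≤ B₀⁻¹|A′|₍₋₁₎ is the «ε arbitrarily close to |A′|» step that
  `B13Contraction113.bound_114` makes honest on the way to (55); under the standing 4C₂B₀ε₃ ≤ 1 it is dominated by (55)
  (4C₂|A′|²₍₋₁₎ ≤ 4C₂ε₃|A′|₍₋₁₎ ≤ B₀⁻¹|A′|₍₋₁₎) — PROVED content, not typed.
* B11.Eq55 · (55) «|D(A′)| = |C_j(L^jηA′ − L^jηHD(A′))| ≤ C₂(L^jη|A′| + B₀|D(A′)|)² ≤ 4C₂|A′|²₍₋₁₎», (56) «C_j(L^jηA′ −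
  L^jηHD(A′)) = Σ_{n≥2} C_j⁽ⁿ⁾(L^jηA′ − L^jηH Σ_{m≥2} D⁽ᵐ⁾(A′)) = Σ_{n≥2} D⁽ⁿ⁾(A′) … a sequence of recursive equations for D⁽ⁿ⁾ …
  D⁽²⁾(A′) = C_j⁽²⁾(L^jηA′), D⁽³⁾(A′) = C_j⁽³⁾(L^jηA′) − 2C_j⁽²⁾(L^jηA′, L^jηHC⁽²⁾(A′)) … C_j⁽²⁾(A′, A″) denotes a symmetric
  bilinear form obtained by polarization» · p. 286 [10] (`p0010.txt:L18–L29`) · row cite `B13Contraction113.bound_114`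
  ((55), proved), `B12Lineariz267.norm_Dt_le`, `B11Prop3Model.Dfix_spec`, `B11Eq44Concrete.bound_114_concrete`; (56):
  `B11Eq56Expansion.D3` (def), `B11Eq56Expansion.eq56_order2`, `B11Eq56Expansion.eq56_order3`,
  `B11Eq56Expansion.eq56_order2_fixedPoint`, `B11Eq56Expansion.eq56_order3_fixedPoint`, `B11Eq56SeriesConcrete.DtN` (def,
  D⁽ⁿ⁾), `B11Eq56SeriesConcrete.hasFPowerSeriesOnBall_Dt_slice`, `B11Eq56SeriesConcrete.Dt_eq_tsum`,
  `B11Eq56SeriesConcrete.DtN_two`, `B11Eq56RecursiveSystem.recursive_system`, `B11Eq56RecursiveSystem.coeff_recursion`,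
  `B11Eq56RecursiveSystem.polarization_vec2`, `B11Eq44Concrete.C2map`, `B11Eq44Concrete.C2map_symm`,
  `B11Eq56Order3Concrete.C3map` (proved ∕ defs).
* B11.Eq57 · «The bound (55) implies that the transformation (47) is defined and analytic on configurations A′ satisfying
  L^jη|A′| < ε₃ on Ω_j, and the values A of this transformation satisfy (57) |A| ≤ |A′| + B₀(L^jη)⁻¹4C₂|A′|²₍₋₁₎ < (ε₃ +
  4C₂B₀ε₃²)(L^jη)⁻¹ < 2ε₃(L^jη)⁻¹ on Ω_j. If we assume also |∇A′| < ε₃(L^jη)⁻², then (58)» · pp. 286–287 [10–11]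
  (`p0010.txt:L30–L34`, `p0011.txt:L2–L3`) · row cite `B12Lineariz267.mapsTo_phi` ((57)–(58) at norm level, proved),
  `B12Lineariz267.norm_hop_Dt_le`, `B11Smallness.ineq57` (ε₃ + 4C₂B₀ε₃² < 2ε₃ from 18C₂B₀ε₃ ≤ 1),
  `B11Eq90V0GroupComposed.norm_T47_lt` (proved).
* **unnumbered, TYPED HERE** · «The transformation is defined for ε₃ satisfying 2ε₃ ≤ c₄ (see Proposition 4 in [4]) and ε₃ ≤
  (18C₂B₀)⁻¹.» · p. 287 [11] (`p0011.txt:L4–L5`) · **`Defined287Printed`** (§1; used).  No row, no declaration: the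
  definedness clause of `B11.Prop3Printed` (conjunct (i), `Def47 U₀ ε₃`) is stated under p. 289's «e.g. 18C₂B₀dc₁(½)ε₃ ≤ 1,
  2ε₃ ≤ c₄»; the model theorem `B11Prop3Model.prop3Printed_model` proves it under that clause (reading (M4): d·c₁(½) ≥ 1).
* B11.Eq59 · «We want to prove that for ε₂ sufficiently small the range of the transformation (47) contains the set (43)»,
  (59) A′ − HD(A′) = A, (60) D(A + HX) = X, (61), «the only change is that the constant C₂ is replaced by 4C₂. Thus for ε₂ ≤
  ¼ε₃, there exists exactly one fixed point of (61) satisfying |X| < B₀⁻¹ε₂, and there exists exactly one solution of Eq. (59)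
  satisfying (62) L^jη|A′|, (L^jη)²|∇A′| < ε₂ + 16C₂B₀ε₂² < 2ε₂ ≤ ½ε₃ on Ω_j … This proves the statement about the range of the
  transformation (47).» · p. 287 [11] (`p0011.txt:L6–L19`) · row cite `B12Lineariz267.phi_psi_of_norm_lt`,
  `B12Lineariz267.psi_mem_of_norm_lt`, `B12Lineariz267.ball_half_subset_image_phi`, `B12Lineariz267.existsUnique_phi_eq`,
  `B12Lineariz267.injOn_phi_ball`, `B12Lineariz267.p267_linearizing_change_of_variables` (proved, via the explicit inverse
  A ↦ A + HC_j(L^jηA)), `B11Smallness.ineq62` (proved), `B11GlobalMin.ChartCovers` (def: the coverage the range statement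
  feeds into Theorem 1's bookkeeping).
* unnumbered · «Let us remark that there are many linearizing transformations. … Our choice h = H is a convenient one … but it
  is by no means a unique choice.» · p. 287 [11] (`p0011.txt:L20–L24`) · no statement of its own; the tree's scheme
  (`B13Contraction113`, `B12Lineariz267`) is typed for an ARBITRARY bounded linear h (`hop`, ‖hX‖ ≤ b‖X‖), which is the
  remark's content.
* B11.Rem@287 · «A second remark concerns regularity properties of D(A′). … it is an analytic function of U₀, because the
  averaging operations Q_j(U₀, ηA) and the operator H(U₀) are analytic in U₀. The analyticity domain is smaller for H(U₀) and
  was described in [5], so D(A′) has the same analyticity domain as H(U₀).» · p. 287 [11] (`p0011.txt:L25–L30`) · row cite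
  `B11.AnData` (field `HAnalytic`); `B11Rem287U0Analytic.analyticAt_D`, `B11Rem287U0Analytic.analyticOnNhd_D_background`,
  `B11Rem287U0Analytic.analyticOnNhd_D_field`, `B11Rem287U0Analytic.analyticOnNhd_D_background_of_subdomain` («the same
  analyticity domain as H(U₀)»), module `B11Rem287U0Concrete` (proved).
* B11.Eq63 · the pseudo-locality paragraph, (63) «⟨(δ/δA′)D(A′), δA′⟩ = (d/dτ)D(A′ + τδA′)|_{τ=0}», (64) 𝔇(A′; c, b), «We will
  prove that this function has an exponential decay», (65)–(68) the integral equation, «As it is easily seen from (66) this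
  equation is an equation on 𝔇 as a function of the variable c ∈ 𝔅_k. The variable b is fixed and treated as a parameter»,
  (69) «≤ (1/r)C₂(2ε₃ + r sup L^jη|H(b, c′)|)² ≤ … = 9C₂B₀ε₃(L^{j′}η)⁻ᵈe^{−δ₀d(c₋,c′₋)}, where we have taken r =
  ε₃(B₀(L^{j′}η)⁻ᵈe^{−δ₀d(c₋,c′₋)})⁻¹», «The above bound shows that the operator in the square bracket in (68) (without the
  identity operator) is of the same type as the operators R studied in [3, 5]. Let us denote it by ℜ.» · pp. 287–289 [11–13]
  (`p0011.txt:L31–L40`, `p0012.txt:L2–L31`, `p0013.txt:L2`) · `B11Eq63FunctionalDerivative.eq63`,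
  `B11Eq63FunctionalDerivative.eq63_deriv`, `B11Eq63FunctionalDerivative.hasFDerivAt_of_eq49` (𝔇 exists: implicit function
  theorem), `B11Eq63FunctionalDerivative.eq65`, `B11Eq63FunctionalDerivative.eq66`, `B11Eq63FunctionalDerivative.eq67`,
  `B11Eq63FunctionalDerivative.eq68`, `B11Eq63FunctionalDerivative.eq68_iff_eq67`, `B11Eq63FunctionalDerivative.eq68_unique`,
  `B11Eq63FunctionalDerivative.radius69`, `B11Eq63FunctionalDerivative.eq69_cauchyFormula`,
  `B11Eq63FunctionalDerivative.eq69_line1`, `B11Eq63FunctionalDerivative.ineq69`, `B11Eq63FunctionalDerivative.ineq69_printed`,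
  `B11Prop3Model.opNorm_R_le` (‖ℜ‖ ≤ 9C₂B₀ε₃), `B11Eq90Transpose.kernel`, `B11Eq90Transpose.colFun` (proved ∕ defs); the
  kernel input «sup_{b ⊂ B^j(c₋)∪B^j(c₊)} L^jη|H(b, c′)| ≤ B₀(L^{j′}η)⁻ᵈe^{−δ₀d(c₋,c′₋)}» of [5] Thm 3.12: module
  `B11HKernelHasMajConcrete`; «of the same type as the operators R studied in [3, 5]» = the majorant class `B11SectG.HasMaj`
  with the scale sums `B11SectG.RowSum` of [3] Lemma 2.1 (`B6.Lemma21Printed`, typed).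
* (70)–(73) · rows B11.Eq70, B11.Eq72, B11.Eq73 of BLOCK 13 (p. 289, `p0013.txt:L2–L16`) — listed for continuity only,
  because Proposition 3 quotes (73): `B11Eq63FunctionalDerivative.eq70`, `B11Eq63FunctionalDerivative.eq70_neumann` ((70)),
  `B11Eq73KernelDecay.ineq71_second` ((71)), `B7.Prop5Printed` ((72) = [4] Prop. 5, typed), `B11Eq73KernelDecay.ineq73`,
  `B11Eq73KernelDecay.ineq73_printed`, `B11Prop3Model.norm_fderiv_Dfix_le` ((73) at norm level) (proved).
* B11.Prop3 · Proposition 3 · p. 289 [13] (`p0013.txt:L17–L23`) · `B11.Prop3Printed` (**used**); inhabited for models: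
  `B11Prop3Model.prop3Printed_model`, `B11Prop3Concrete.prop3_concrete` (proved); consumer slot `DagBinding.B11Leaf` (field
  `p3`).
* B11.Rem@289 · «The operator 𝔇(A′) is an analytic function in A′, and its expansion begins with a linear term in A′, coming
  from the differentiation of D⁽²⁾(A′) = C⁽²⁾(A′). If we subtract these terms from 𝔇(A′), then we get an operator 𝔇₂(A′) for
  which we have the bound (73) with ε₃² instead of ε₃.» · p. 289 [13] (`p0013.txt:L24–L28`) · row cite
  `B11SchwarzRemainder.reading_frakD2` (proved; with `B11SchwarzRemainder.tightness_witness`), `B11Rem289Concrete.fderiv_Dt_zero`,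
  `B11Rem289Concrete.norm_frakD2_apply_le_sq`, `B11Rem289KernelColumnsCarrier.fderiv_quadPart_eq`,
  `B11Rem289KernelColumnsCarrier.opNorm_kernel_H_fderiv_quadPart_le` (proved).

HONEST SCOPE.  (a) `Defined287Printed` is a HYPOTHESIS SCHEMA of printed shape over the abstract carrier `B11.LGData`: its
conclusion is the carrier's own predicate `Def47 U₀ ε₃` («the transformation (47) is defined and analytic on the set (43)
with parameter ε₃» — the reading of record of `B11.Prop3Printed`; print's p. 286 domain {L^jη|A′| < ε₃ on Ω_j} contains the
set (43)_{ε₃}, so the typed conclusion is implied by, not stronger than, print), its frame is the frame of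
`B11.Prop3Printed` (the hypothesis (14) at U₀, `Sat14 (C₁B₃ε₁) (C₁ε₁) V U₀`), and its smallness clause is p. 287's own
(«2ε₃ ≤ c₄ and ε₃ ≤ (18C₂B₀)⁻¹», norm level).  It differs from conjunct (i) of `B11.Prop3Printed` EXACTLY in that clause
(p. 289: «e.g. 18C₂B₀dc₁(½)ε₃ ≤ 1, 2ε₃ ≤ c₄»); the printed relation between the two clauses is kernel-checked
(`threshold287_of_289`: for 1 ≤ d·c₁(½) and 0 ≤ C₂B₀ε₃ the p. 289 clause implies the p. 287 clause, so `Hyp.def47_eg`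
recovers Proposition 3's definedness from the p. 287 sentence), and for the model family both hold (`defined287_model`).
(b) The bundle `Hyp` conjoins the p. 287 sentence and Proposition 3; the redundancy (Proposition 3 «gathers the results of
this section») is print's.  Sect. B ((24)–(43)) contributes NO conjunct: it has no proposition, and every one of its
displays and sentences is realised in the tree by a definition with body or a PROVED theorem (INDEX) — a proved statement
is not a hypothesis.  (44) and (45)–(46) are statements of [4] and [5], typed over those papers' carriers
(`B7.Prop4Printed`, `B9.Thm312_313Printed`), cited and not conjoined.  (c) `hyp_model` inhabits the bundle for the Sect. C
model family of `B11Prop3Model` (one complex Banach space of configurations per index, (73) at norm level — that module's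
declared readings (M1)–(M7)); it constructs neither C_j(U₀, ·) nor H(U₀) on Bałaban's lattice and proves nothing of [4]
Props 4 ∕ 5 ∕ 7 or [5] Thm 3.12.  (d) No `instance`, no `notation`, 0 sorry; imports `…B11Prop3Model` (hence `…B11`,
`…B12Lineariz267`, `…B13Contraction113`, `…B11Eq63FunctionalDerivative`) and `…DagBinding` only.  NOT a node discharge, NOT
summit progress; nothing continuum, nothing about the mass gap.
-/

namespace Literature.MathematicalPhysics.QuantumFieldTheory.Balaban1983to89.B11Carve12SectsBCHyp

variable {I : Type}

/-! ## §1 The p. 287 definedness sentence (no declaration in the tree): hypothesis form -/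

/-- **p. 287 [PDF 11], ll. 4–5** (text layer `p0011.txt:L4–L5`), verbatim: «The transformation is defined for ε₃ satisfying
2ε₃ ≤ c₄ (see Proposition 4 in [4]) and ε₃ ≤ (18C₂B₀)⁻¹.»  Context (p. 286 last sentence – p. 287 l. 3, verbatim): «The
bound (55) implies that the transformation (47) is defined and analytic on configurations A′ satisfying L^jη|A′| < ε₃ on
Ω_j, and the values A of this transformation satisfy [(57)]. If we assume also |∇A′| < ε₃(L^jη)⁻², then [(58)].» ((57)–(58)
= row B11.Eq57, PROVED at norm level: `B12Lineariz267.mapsTo_phi`; the two printed restrictions are the contraction condition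
of p. 286 «9C₂B₀ε₃ ≤ 1/2, i.e. ε₃ ≤ (18C₂B₀)⁻¹» and the radius of [4] Prop. 4 needed in (52).)  TYPED over the Sect. A–E
carrier of `…Balaban1983to89.B11` in the frame of `B11.Prop3Printed` (the background U₀ of (14), `Sat14 (C₁B₃ε₁) (C₁ε₁) V
U₀`, pp. 279–280; the constants C₂, c₄ of [4] Prop. 4 and B₀ of [5] Thm 3.12 as parameters): for every index, every
0 < ε₁, every 0 < ε₃ with 2ε₃ ≤ c₄ and 18C₂B₀ε₃ ≤ 1, and every (V, U₀) satisfying (14), the transformation (47) is defined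
and analytic on the set (43) with parameter ε₃ — the carrier's predicate `Def47 U₀ ε₃` (print's domain {L^jη|A′| < ε₃}
contains (43)_{ε₃}).  NOT a restatement of `B11.Prop3Printed`: that declaration's definedness conjunct is stated under
p. 289's «e.g. 18C₂B₀dc₁(½)ε₃ ≤ 1, 2ε₃ ≤ c₄» (the factor d·c₁(½) enters only through the Neumann series (71) behind (73));
the printed implication between the two clauses is `threshold287_of_289` below. [cite: Balaban1985Variational, p.287 lines 4–5 (after (58)) + (47) p.285] -/
def Defined287Printed (C₁ B₃ C₂ B₀ c₄ : ℝ) (fam : I → B11.LGData) : Prop :=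
  ∀ i : I, ∀ ε₁ ε₃ : ℝ, 0 < ε₁ → 0 < ε₃ → 2 * ε₃ ≤ c₄ → 18 * C₂ * B₀ * ε₃ ≤ 1 →
    ∀ V : (fam i).Bdry, ∀ U₀ : (fam i).Cfg, (fam i).Sat14 (C₁ * B₃ * ε₁) (C₁ * ε₁) V U₀ →
      (fam i).Def47 U₀ ε₃

/-! ## §2 The bundle keyed to `stmt-QuantumFields-19200` -/

/-- **BLOCK 12 OF [B11] (Sects. B–C, pp. 281–289) AS ONE HYPOTHESIS**, keyed to `stmt-QuantumFields-19200` (also feeds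
`stmt-QuantumFields-20541`): the conjunction, BY NAME, of the block's printed statements in hypothesis form over the
Sect. A–E carrier `B11.LGData` — (1) the p. 287 definedness sentence `Defined287Printed`; (2) Proposition 3 (p. 289 [PDF 13],
«Let us gather the results of this section in Proposition 3. The transformation (47) satisfying the identity (48), i.e.
linearizing the averaging operation Q(ηA), is defined and analytic for A′ satisfying (43) with ε₃ sufficiently small (e.g.
18C₂B₀dc₁(½)ε₃ ≤ 1, 2ε₃ ≤ c₄). The range of this transformation contains the set (43) with ε₂ ≤ ¼ε₃, and is contained in the
corresponding set with 2ε₃ instead of ε₂. The function D(A′) satisfies the bound (55) and its functional derivative satisfies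
the bound (73).») `B11.Prop3Printed`.  A node prover takes `(h : Hyp …)`.  Sect. B's displays (24)–(43) and Sect. C's
displays (44)–(69) are PROVED in the tree or are typed statements of [4] ∕ [5] over those papers' carriers (INDEX in the
module docstring) and are therefore not conjuncts.  Constants: C₁, B₃ of (14); C₂, c₄ of [4] Prop. 4; C₃ of [4] Prop. 5;
B₀, δ₀ of [5] Thm 3.12; c₁(½) =: `c1h` of [3] Lemma 2.1. [cite: Balaban1985Variational, Prop. 3 p.289 + p.287 lines 4–5 + Sects. B–C pp.281–289] -/
def Hyp (C₁ B₃ C₂ C₃ B₀ c1h c₄ δ₀ : ℝ) (fam : I → B11.LGData) : Prop :=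
  Defined287Printed C₁ B₃ C₂ B₀ c₄ fam ∧ B11.Prop3Printed C₁ B₃ C₂ C₃ B₀ c1h c₄ δ₀ fam

/-- **The bundle at the consumer's carrier record** `DagBinding.PrintedCarriers11` (the record over which N07's leaf
`DagBinding.B11Leaf` is stated: index type `I11`, Landau-gauge family `famLG`, printed constants `C₁, B₃, C₂, C₃, B₀, c1h,
c₄, δ₀`): `Hyp` at `Z.famLG` with `Z`'s constants, so that `HypAt.leafP3` is literally the type of the field
`DagBinding.B11Leaf.p3`. [cite: Balaban1985Variational, Prop. 3 p.289 + p.287 lines 4–5] -/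
def HypAt (Z : DagBinding.PrintedCarriers11) : Prop :=
  Hyp Z.C₁ Z.B₃ Z.C₂ Z.C₃ Z.B₀ Z.c1h Z.c₄ Z.δ₀ Z.famLG

/-! ## §3 How the bundle sits in the tree (pointers; the theorems are the tree's, nothing new)

With `h : Hyp C₁ B₃ C₂ C₃ B₀ c1h c₄ δ₀ fam` (`obtain ⟨h287, h3⟩ := h`):
* p. 289 Proposition 3 as typed is the conjunct `h3` (`Hyp.prop3`); its five clauses at an index, for 0 < ε₁, 0 < ε₃ with
  p. 289's clause and (V, U₀) satisfying (14): `Def47` (`Hyp.def47_eg`, also from `h287` by `threshold287_of_289` when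
  1 ≤ d·c₁(½)), the range clause (`Hyp.range`), the image clause (`Hyp.image`), (55) (`Hyp.bound55`), (73) (`Hyp.kerD73`,
  with print's O(1));
* p. 287: definedness under the norm-level clause alone (`Hyp.def47`);
* the consumer: `HypAt Z` supplies the `p3` slot of `DagBinding.B11Leaf Z` (`HypAt.leafP3`), and conversely the leaf plus
  the p. 287 sentence give the bundle (`hypAt_of_leaf`);
* non-vacuity: for every model family `δ i : B11Prop3Model.LinDatum …` (one complex Banach space of configurations per
  index, the inputs (44), (46), (72) read as (14), (73) at norm level) the bundle HOLDS (`hyp_model`), by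
  `B11Prop3Model.prop3Printed_model` and `defined287_model` — the latter is part (i) of that module's proof run under the
  p. 287 clause (`B12Lineariz267.smallness_of_le`, `B12Lineariz267.differentiableOn_Dt_line`). -/

/-! ## §4 The §3 recipes, kernel-checked -/

section Delivery

variable {C₁ B₃ C₂ C₃ B₀ c1h c₄ δ₀ : ℝ} {fam : I → B11.LGData}

/-- The bundle IS the two-fold conjunction (1)–(2) of its docstring, definitionally (unfolding lemma, no content beyond
`Hyp`). [cite: Balaban1985Variational, Prop. 3 p.289 + p.287 lines 4–5] -/
theorem hyp_iff :
    Hyp C₁ B₃ C₂ C₃ B₀ c1h c₄ δ₀ fam ↔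
      Defined287Printed C₁ B₃ C₂ B₀ c₄ fam ∧ B11.Prop3Printed C₁ B₃ C₂ C₃ B₀ c1h c₄ δ₀ fam :=
  Iff.rfl

/-- Conjunct (1): the p. 287 definedness sentence, `Defined287Printed`. [cite: Balaban1985Variational, p.287 lines 4–5] -/
theorem Hyp.defined287 (h : Hyp C₁ B₃ C₂ C₃ B₀ c1h c₄ δ₀ fam) : Defined287Printed C₁ B₃ C₂ B₀ c₄ fam :=
  h.1

/-- Conjunct (2): Proposition 3 as typed, `B11.Prop3Printed`. [cite: Balaban1985Variational, Prop. 3 p.289] -/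
theorem Hyp.prop3 (h : Hyp C₁ B₃ C₂ C₃ B₀ c1h c₄ δ₀ fam) : B11.Prop3Printed C₁ B₃ C₂ C₃ B₀ c1h c₄ δ₀ fam :=
  h.2

/-- **p. 287 over the bundle**: under «2ε₃ ≤ c₄ and ε₃ ≤ (18C₂B₀)⁻¹» alone the transformation (47) is defined and analytic on
(43)_{ε₃} (`Def47`), at every background U₀ of (14). [cite: Balaban1985Variational, p.287 lines 4–5] -/
theorem Hyp.def47 (h : Hyp C₁ B₃ C₂ C₃ B₀ c1h c₄ δ₀ fam) {i : I} {ε₁ ε₃ : ℝ} (hε₁ : 0 < ε₁) (hε₃ : 0 < ε₃)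
    (h2 : 2 * ε₃ ≤ c₄) (h18 : 18 * C₂ * B₀ * ε₃ ≤ 1) {V : (fam i).Bdry} {U₀ : (fam i).Cfg}
    (h14 : (fam i).Sat14 (C₁ * B₃ * ε₁) (C₁ * ε₁) V U₀) : (fam i).Def47 U₀ ε₃ :=
  h.1 i ε₁ ε₃ hε₁ hε₃ h2 h18 V U₀ h14

/-- **The printed threshold arithmetic** (p. 289 «e.g. 18C₂B₀dc₁(½)ε₃ ≤ 1» versus p. 287 «ε₃ ≤ (18C₂B₀)⁻¹»): for 1 ≤ d·c₁(½)
(d ≥ 1; the scale sum c₁(½) of [3] Lemma 2.1 contains its diagonal term — reading (M4) of `B11Prop3Model`) and 0 ≤ C₂B₀ε₃,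
Proposition 3's clause implies the p. 287 clause.  Real arithmetic (cf. `B11Prop3Model.smallness`). [cite: Balaban1985Variational, Prop. 3 p.289 + p.287 lines 4–5] -/
theorem threshold287_of_289 {C₂ B₀ d c1h ε₃ : ℝ} (h0 : 0 ≤ C₂ * B₀ * ε₃) (hdc : 1 ≤ d * c1h)
    (h18 : 18 * C₂ * B₀ * d * c1h * ε₃ ≤ 1) : 18 * C₂ * B₀ * ε₃ ≤ 1 := by
  have hmono : 18 * C₂ * B₀ * ε₃ * 1 ≤ 18 * C₂ * B₀ * ε₃ * (d * c1h) :=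
    mul_le_mul_of_nonneg_left hdc (by linarith)
  have hring : 18 * C₂ * B₀ * ε₃ * (d * c1h) = 18 * C₂ * B₀ * d * c1h * ε₃ := by ring
  linarith

/-- **Proposition 3's definedness clause from the p. 287 sentence** (print's «e.g.»): under p. 289's «18C₂B₀dc₁(½)ε₃ ≤ 1,
2ε₃ ≤ c₄» with 1 ≤ d·c₁(½) and 0 ≤ C₂B₀ε₃, conjunct (1) already gives `Def47 U₀ ε₃`. [cite: Balaban1985Variational, Prop. 3 p.289 + p.287 lines 4–5] -/
theorem Hyp.def47_eg (h : Hyp C₁ B₃ C₂ C₃ B₀ c1h c₄ δ₀ fam) {i : I} {ε₁ ε₃ : ℝ} (hε₁ : 0 < ε₁) (hε₃ : 0 < ε₃)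
    (h2 : 2 * ε₃ ≤ c₄) (h18 : 18 * C₂ * B₀ * (fam i).dim * c1h * ε₃ ≤ 1) (h0 : 0 ≤ C₂ * B₀ * ε₃)
    (hdc : 1 ≤ ((fam i).dim : ℝ) * c1h) {V : (fam i).Bdry} {U₀ : (fam i).Cfg}
    (h14 : (fam i).Sat14 (C₁ * B₃ * ε₁) (C₁ * ε₁) V U₀) : (fam i).Def47 U₀ ε₃ :=
  h.def47 hε₁ hε₃ h2 (threshold287_of_289 h0 hdc h18) h14

/-- **Proposition 3, range clause, over the bundle** («The range of this transformation contains the set (43) with ε₂ ≤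
¼ε₃»): at an index, under p. 289's clause and (14) at U₀, every A in (43)_{ε₂}, ε₂ ≤ ¼ε₃, is A′ − HD(A′) for some A′ in
(43)_{ε₃}. [cite: Balaban1985Variational, Prop. 3 p.289 + (59)–(62) p.287] -/
theorem Hyp.range (h : Hyp C₁ B₃ C₂ C₃ B₀ c1h c₄ δ₀ fam) {i : I} {ε₁ ε₃ : ℝ} (hε₁ : 0 < ε₁) (hε₃ : 0 < ε₃)
    (h18 : 18 * C₂ * B₀ * (fam i).dim * c1h * ε₃ ≤ 1) (h2 : 2 * ε₃ ≤ c₄) {V : (fam i).Bdry} {U₀ : (fam i).Cfg}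
    (h14 : (fam i).Sat14 (C₁ * B₃ * ε₁) (C₁ * ε₁) V U₀) {ε₂ : ℝ} (hε₂ : ε₂ ≤ ε₃ / 4) {A : (fam i).Fld}
    (hA : (fam i).In43 U₀ ε₂ A) : ∃ A' : (fam i).Fld, (fam i).In43 U₀ ε₃ A' ∧ (fam i).T47 U₀ A' = A := by
  obtain ⟨O₁, -, H⟩ := h.2
  exact (H i ε₁ ε₃ hε₁ hε₃ h18 h2 V U₀ h14).2.1 ε₂ hε₂ A hA

/-- **Proposition 3, image clause, over the bundle** («and is contained in the corresponding set with 2ε₃ instead of ε₂»):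
(47) maps (43)_{ε₃} into (43)_{2ε₃}. [cite: Balaban1985Variational, Prop. 3 p.289 + (57)–(58) pp.286–287] -/
theorem Hyp.image (h : Hyp C₁ B₃ C₂ C₃ B₀ c1h c₄ δ₀ fam) {i : I} {ε₁ ε₃ : ℝ} (hε₁ : 0 < ε₁) (hε₃ : 0 < ε₃)
    (h18 : 18 * C₂ * B₀ * (fam i).dim * c1h * ε₃ ≤ 1) (h2 : 2 * ε₃ ≤ c₄) {V : (fam i).Bdry} {U₀ : (fam i).Cfg}
    (h14 : (fam i).Sat14 (C₁ * B₃ * ε₁) (C₁ * ε₁) V U₀) {A' : (fam i).Fld} (hA' : (fam i).In43 U₀ ε₃ A') :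
    (fam i).In43 U₀ (2 * ε₃) ((fam i).T47 U₀ A') := by
  obtain ⟨O₁, -, H⟩ := h.2
  exact (H i ε₁ ε₃ hε₁ hε₃ h18 h2 V U₀ h14).2.2.1 A' hA'

/-- **Proposition 3, the bound (55), over the bundle** («The function D(A′) satisfies the bound (55)», |D(A′)| ≤
4C₂|A′|²₍₋₁₎). [cite: Balaban1985Variational, Prop. 3 p.289 + (55) p.286] -/
theorem Hyp.bound55 (h : Hyp C₁ B₃ C₂ C₃ B₀ c1h c₄ δ₀ fam) {i : I} {ε₁ ε₃ : ℝ} (hε₁ : 0 < ε₁) (hε₃ : 0 < ε₃)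
    (h18 : 18 * C₂ * B₀ * (fam i).dim * c1h * ε₃ ≤ 1) (h2 : 2 * ε₃ ≤ c₄) {V : (fam i).Bdry} {U₀ : (fam i).Cfg}
    (h14 : (fam i).Sat14 (C₁ * B₃ * ε₁) (C₁ * ε₁) V U₀) {A' : (fam i).Fld} (hA' : (fam i).In43 U₀ ε₃ A') :
    (fam i).normD U₀ A' ≤ 4 * C₂ * (fam i).nM1 U₀ A' ^ 2 := by
  obtain ⟨O₁, -, H⟩ := h.2
  exact (H i ε₁ ε₃ hε₁ hε₃ h18 h2 V U₀ h14).2.2.2.1 A' hA'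

/-- **Proposition 3, the bound (73), over the bundle** («its functional derivative satisfies the bound (73)», |𝔇(A′; c, b)| ≤
O(1)C₃ε₃(L^jη)^{−d+1}e^{−½δ₀d(c₋,y)}, b ∈ B^j(y), y ∈ Λ_j): print's O(1) chosen before the index. [cite: Balaban1985Variational, Prop. 3 p.289 + (73) p.289] -/
theorem Hyp.kerD73 (h : Hyp C₁ B₃ C₂ C₃ B₀ c1h c₄ δ₀ fam) :
    ∃ O₁ : ℝ, 0 < O₁ ∧ ∀ i : I, ∀ ε₁ ε₃ : ℝ, 0 < ε₁ → 0 < ε₃ →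
      18 * C₂ * B₀ * (fam i).dim * c1h * ε₃ ≤ 1 → 2 * ε₃ ≤ c₄ →
      ∀ V : (fam i).Bdry, ∀ U₀ : (fam i).Cfg, (fam i).Sat14 (C₁ * B₃ * ε₁) (C₁ * ε₁) V U₀ →
        ∀ A' : (fam i).Fld, ∀ c : (fam i).Cell, ∀ y : (fam i).Site, (fam i).In43 U₀ ε₃ A' →
          (fam i).kerD U₀ A' c y ≤ O₁ * C₃ * ε₃ * ((fam i).L ^ (fam i).scale y * (fam i).eta) ^ (1 - ((fam i).dim : ℝ)) *
            Real.exp (-(δ₀ / 2) * (fam i).dist c y) := by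
  obtain ⟨O₁, hO₁, H⟩ := h.2
  exact ⟨O₁, hO₁, fun i ε₁ ε₃ hε₁ hε₃ h18 h2 V U₀ h14 => (H i ε₁ ε₃ hε₁ hε₃ h18 h2 V U₀ h14).2.2.2.2⟩

end Delivery

section Consumer

/-- The bundle at the consumer's record IS `Hyp` at `Z`'s family and constants (unfolding lemma). [cite: Balaban1985Variational, Prop. 3 p.289 + p.287 lines 4–5] -/
theorem hypAt_iff (Z : DagBinding.PrintedCarriers11) :
    HypAt Z ↔ Defined287Printed Z.C₁ Z.B₃ Z.C₂ Z.B₀ Z.c₄ Z.famLG ∧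
      B11.Prop3Printed Z.C₁ Z.B₃ Z.C₂ Z.C₃ Z.B₀ Z.c1h Z.c₄ Z.δ₀ Z.famLG :=
  Iff.rfl

/-- **WIRING, kernel-checked**: the bundle at the consumer's record supplies the `p3` slot of N07's leaf
`DagBinding.B11Leaf Z` — literally its type. [cite: Balaban1985Variational, Prop. 3 p.289] -/
theorem HypAt.leafP3 {Z : DagBinding.PrintedCarriers11} (h : HypAt Z) :
    B11.Prop3Printed Z.C₁ Z.B₃ Z.C₂ Z.C₃ Z.B₀ Z.c1h Z.c₄ Z.δ₀ Z.famLG :=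
  h.2

/-- Conversely, N07's leaf `DagBinding.B11Leaf Z` (field `p3`) together with the p. 287 sentence gives the block's bundle at
the consumer's record. [cite: Balaban1985Variational, Prop. 3 p.289 + p.287 lines 4–5] -/
theorem hypAt_of_leaf {Z : DagBinding.PrintedCarriers11} (hZ : DagBinding.B11Leaf Z)
    (h287 : Defined287Printed Z.C₁ Z.B₃ Z.C₂ Z.B₀ Z.c₄ Z.famLG) : HypAt Z :=
  ⟨h287, hZ.p3⟩

end Consumer

/-! ### Non-vacuity: the bundle holds, by name, for the Sect. C model family of `B11Prop3Model` -/

section Model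

open B11Prop3Model

/-- **The p. 287 sentence HOLDS for every model family** of Sect. C data (`B11Prop3Model.LinDatum`: per index one complex
Banach space of configurations A′ with the norm of (43), one complete complex Banach space of values of D, backgrounds U₀
carrying H(U₀) and A ↦ C_j(L^jηA); (14) read as the inputs (44), (46), (72) — that module's readings (M1)–(M5)).  Proof =
part (i) of `B11Prop3Model.prop3Printed_model` run under the p. 287 clause: «18C₂B₀ε₃ ≤ 1» gives the contraction
«9C₂B₀ε₃ < 1» and the self-map «4C₂B₀ε₃ ≤ 1» (`B12Lineariz267.smallness_of_le`), «2ε₃ ≤ c₄» gives the radius 3ε₃ ≤ 2c₄ for the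
Cauchy circles of (53); then (49) holds for the selected D on ‖A′‖ < ε₃ (`B11Prop3Model.Dfix_fix`) and A′ ↦ A′ − HD(A′) is
holomorphic along complex lines there (`B12Lineariz267.differentiableOn_Dt_line`).  Hypotheses C₂, B₀ ≥ 0. [cite: Balaban1985Variational, p.287 lines 4–5 + (49)–(55) pp.285–286] -/
theorem defined287_model {J : Type} (𝒴f 𝒳f Cfgf Bdryf : J → Type)
    [∀ i, NormedAddCommGroup (𝒴f i)] [∀ i, NormedSpace ℂ (𝒴f i)]
    [∀ i, NormedAddCommGroup (𝒳f i)] [∀ i, NormedSpace ℂ (𝒳f i)] [∀ i, CompleteSpace (𝒳f i)]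
    {C₁ B₃ C₂ C₃ B₀ c₄ : ℝ} (hC₂ : 0 ≤ C₂) (hB₀ : 0 ≤ B₀)
    (δ : ∀ i, LinDatum (𝒴f i) (𝒳f i) (Cfgf i)) :
    Defined287Printed C₁ B₃ C₂ B₀ c₄ (fun i => (δ i).toLGData (Bdryf i) C₂ C₃ B₀ c₄) := by
  intro i ε₁ ε₃ _ hε₃ h2 h18 V U₀ h14
  dsimp only [LinDatum.toLGData] at h14 ⊢
  have hin : Inputs ((δ i).Ct U₀) ((δ i).hop U₀) C₂ C₃ B₀ c₄ := h14
  obtain ⟨hq, _⟩ := B12Lineariz267.smallness_of_le C₂ B₀ ε₃ h18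
  have hRC : 3 * ε₃ ≤ 2 * c₄ := by linarith
  have hQ : B13Contraction113.QuadAnalytic ((δ i).Ct U₀) C₂ (2 * c₄) := hin.quadAnalytic
  have hH := hin.norm_H
  have hDball := Dfix_ball (Ct := (δ i).Ct U₀) (hop := (δ i).hop U₀) hQ hC₂ hB₀ hH hq hRC
  have hDfix := Dfix_fix (Ct := (δ i).Ct U₀) (hop := (δ i).hop U₀) hQ hC₂ hB₀ hH hq hRC
  refine ⟨fun A' hA' => hDfix A' hA', fun P Q => ?_⟩
  have hD := B12Lineariz267.differentiableOn_Dt_line hQ hC₂ hB₀ hH hq hRC hin.prop4Hyp.differentiableOn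
    hDball hDfix P Q
  have hlin : DifferentiableOn ℂ (fun σ : ℂ => P + σ • Q) {σ : ℂ | ‖P + σ • Q‖ < ε₃} :=
    ((differentiable_id.smul_const Q).const_add P).differentiableOn
  have hcomp : DifferentiableOn ℂ
      (fun σ : ℂ => hin.hopL (Dfix ((δ i).Ct U₀) ((δ i).hop U₀) C₂ (P + σ • Q)))
      {σ : ℂ | ‖P + σ • Q‖ < ε₃} :=
    hin.hopL.differentiable.comp_differentiableOn hD
  exact hlin.sub hcomp

/-- **THE BUNDLE IS INHABITED for every model family of Sect. C data** (`B11Prop3Model.LinDatum`; printed constants fixed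
before the index: C₂, C₃, B₀ ≥ 0, c₄ > 0, c₁(½) ≥ 1): conjunct (1) by `defined287_model`, conjunct (2) — Proposition 3 as
typed — by `B11Prop3Model.prop3Printed_model` ((i)–(iv) and (73) at norm level, O(1) = 4).  Non-vacuity of `Hyp`, by
name; proves nothing of [4] ∕ [5] (the inputs (44), (46), (72) are the model's (14)). [cite: Balaban1985Variational, Prop. 3 p.289 + p.287 lines 4–5] -/
theorem hyp_model {J : Type} (𝒴f 𝒳f Cfgf Bdryf : J → Type)
    [∀ i, NormedAddCommGroup (𝒴f i)] [∀ i, NormedSpace ℂ (𝒴f i)] [∀ i, CompleteSpace (𝒴f i)]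
    [∀ i, NormedAddCommGroup (𝒳f i)] [∀ i, NormedSpace ℂ (𝒳f i)] [∀ i, CompleteSpace (𝒳f i)]
    {C₁ B₃ C₂ C₃ B₀ c1h c₄ δ₀ : ℝ} (hC₂ : 0 ≤ C₂) (hC₃ : 0 ≤ C₃) (hB₀ : 0 ≤ B₀) (hc₄ : 0 < c₄)
    (hc1h : 1 ≤ c1h) (δ : ∀ i, LinDatum (𝒴f i) (𝒳f i) (Cfgf i)) :
    Hyp C₁ B₃ C₂ C₃ B₀ c1h c₄ δ₀ (fun i => (δ i).toLGData (Bdryf i) C₂ C₃ B₀ c₄) :=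
  ⟨defined287_model 𝒴f 𝒳f Cfgf Bdryf hC₂ hB₀ δ,
    prop3Printed_model 𝒴f 𝒳f Cfgf Bdryf hC₂ hC₃ hB₀ hc₄ hc1h δ⟩

end Model

end Literature.MathematicalPhysics.QuantumFieldTheory.Balaban1983to89.B11Carve12SectsBCHyp
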